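import Summits.Ventures.HodgeRepro2.WeilIntegral

/-!
# Weil vectors, the vanishing lemma (V), and the detection formula of Lemma A5.6 (A3, seat p5)

Continues `WeilPlanes.lean` / `WeilIntegral.lean` (route/T4-A3-p5.md §A5.3–A5.6).  For a set `P₀`
of planes (the four planes `(i, ν(σ))` of an embedding `σ`) and a side `s : Bool`, the Weil vector
`w_σ = e_{1,σ} ∧ ⋯ ∧ e_{4,σ}` is `weil P₀ s = mono (P₀.toList.map (·, s))`, and `w_σ̄ = weil P₀ (!s)`.

Main results (kernel-checked):
* `mono_map_mul_mono_map`: the exact sign of `(x₁ ∧ ⋯ ∧ x_n) ∧ (y₁ ∧ ⋯ ∧ y_n) = ± ∏ (x_i ∧ y_i)`,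
  namely `(−1)^{n(n−1)/2}`; for `n = 4` and the Weil vectors, `w_σ̄ ∧ w_σ = E_{P₀}` exactly
  (`weil_conj_mul_weil_four`) — the sign computation of Lemma A5.6.
* `integral_weil_conj_mul_ET_mul_weil`: `∫_B w_σ̄ ∧ E_{I_σ} ∧ w_σ = vol` (exact, sign `+1`).
* `integral_mono_mul_ET_mul_weil_eq_zero`: every other degree-4 monomial pairs to `0` with
  `E_{I_σ} ∧ w_σ` — so `v ↦ ∫_B v ∧ E_{I_σ} ∧ w_σ` reads off the `w_σ̄`-coordinate of `v`
  (`integral_sum_mul_ET_mul_weil`), which is Lemma A5.6 (with Lemma A5.4 supplying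
  `θ^8 ∧ w_σ = 8!·c_{I_σ}·E_{I_σ} ∧ w_σ`).
* `integral_theta_pow_mul_mono_eq_zero_of_half` (Lemma (V)(i)): `Ψ(e_M) = ∫_B θ^r ∧ e_M = 0` when
  `M` is half in some plane; `integral_theta_pow_mul_ET` (Lemma (V)(ii)):
  `∫_B θ^r ∧ E_T = r!·c_{𝒫∖T}·vol` if `|T| = |𝒫| − r`, and `0` otherwise.
-/

namespace Summit.Ventures.HodgeRepro2.WeilDetect

open Summit.Ventures.HodgeRepro2.WeilPlanes Summit.Ventures.HodgeRepro2.WeilIntegral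

variable {ι : Type*} [DecidableEq ι]

/-! ## 1. The sign of `(∏ x_i) ∧ (∏ y_i)` -/

/-- `(x₁ ∧ ⋯ ∧ x_n) ∧ (y₁ ∧ ⋯ ∧ y_n) = (−1)^{n(n−1)/2}·∏_i (x_i ∧ y_i)` for generators
`x_i = gen (f p_i)`, `y_i = gen (g p_i)` (no distinctness needed). -/
theorem mono_map_mul_mono_map (L : List ι) (f g : ι → Gen ι) :
    mono (L.map f) * mono (L.map g) =
      ((-1 : ℂ) ^ (L.length.choose 2)) • (L.map fun p => gen (f p) * gen (g p)).prod := by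
  induction L with
  | nil => simp
  | cons p L ih =>
    have hswap : mono (L.map f) * gen (g p) =
        ((-1 : ℂ) ^ L.length) • (gen (g p) * mono (L.map f)) := by
      rw [gen_mul_mono_swap, smul_smul, List.length_map, ← pow_add, ← two_mul, pow_mul]
      simp
    simp only [List.map_cons, mono_cons, List.length_cons, List.prod_cons]
    rw [Nat.choose_succ_succ, Nat.choose_one_right, pow_add]
    calc gen (f p) * mono (L.map f) * (gen (g p) * mono (L.map g))
        = gen (f p) * (mono (L.map f) * gen (g p)) * mono (L.map g) := by
          simp only [mul_assoc]
      _ = ((-1 : ℂ) ^ L.length) • (gen (f p) * gen (g p) * (mono (L.map f) * mono (L.map g))) := by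
          rw [hswap]
          simp only [mul_smul_comm, smul_mul_assoc, mul_assoc]
      _ = ((-1 : ℂ) ^ L.length * (-1 : ℂ) ^ (L.length.choose 2)) •
            (gen (f p) * gen (g p) * (L.map fun p => gen (f p) * gen (g p)).prod) := by
          rw [ih, mul_smul_comm, smul_smul]

/-! ## 2. Weil vectors -/

/-- The Weil vector `w_σ = e_{1,σ} ∧ ⋯ ∧ e_{4,σ}`: one generator of side `s` in each plane of
`P₀` (the planes `(i, ν(σ))`, `s = false` if `σ = τ_ν`, `s = true` if `σ = τ̄_ν`); `w_σ̄` is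
`weil P₀ (!s)`. -/
noncomputable def weil (P₀ : Finset ι) (s : Bool) : A ι := mono (P₀.toList.map fun p => (p, s))

/-- The generator list of `weil P₀ s`. -/
noncomputable def weilList (P₀ : Finset ι) (s : Bool) : List (Gen ι) := P₀.toList.map fun p => (p, s)

/-- `weil P₀ s = mono (weilList P₀ s)`. -/
theorem weil_eq_mono (P₀ : Finset ι) (s : Bool) : weil P₀ s = mono (weilList P₀ s) := rfl

omit [DecidableEq ι] in
/-- Membership in `weilList`. -/
theorem mem_weilList {P₀ : Finset ι} {s : Bool} {j : Gen ι} :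
    j ∈ weilList P₀ s ↔ j.1 ∈ P₀ ∧ j.2 = s := by
  unfold weilList
  simp only [List.mem_map, Finset.mem_toList]
  constructor
  · rintro ⟨p, hp, rfl⟩
    exact ⟨hp, rfl⟩
  · rintro ⟨hp, hs⟩
    exact ⟨j.1, hp, by rw [← hs]⟩

omit [DecidableEq ι] in
/-- `weilList P₀ s` is repetition-free. -/
theorem nodup_weilList (P₀ : Finset ι) (s : Bool) : (weilList P₀ s).Nodup :=
  List.Nodup.map (fun a b (h : (a, s) = (b, s)) => (Prod.mk.inj h).1) (Finset.nodup_toList P₀)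

omit [DecidableEq ι] in
/-- `weilList P₀ s` has `|P₀|` entries. -/
theorem length_weilList (P₀ : Finset ι) (s : Bool) : (weilList P₀ s).length = P₀.card := by
  simp [weilList]

/-- The sign of the two generators of a plane in the two orders. -/
theorem gen_not_mul_gen (p : ι) (s : Bool) :
    gen (p, !s) * gen (p, s) = (if s then (1 : ℂ) else -1) • E p := by
  cases s
  · simp [E, gen_mul_gen_swap (p, true) (p, false)]
  · simp [E]

omit [DecidableEq ι] in
/-- `∏ (c • x_i) = c^n • ∏ x_i` for a list. -/
theorem prod_map_smul (L : List ι) (c : ℂ) (x : ι → A ι) :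
    (L.map fun p => c • x p).prod = (c ^ L.length) • (L.map x).prod := by
  induction L with
  | nil => simp
  | cons p L ih => rw [List.map_cons, List.prod_cons, ih, List.map_cons, List.prod_cons,
      List.length_cons, pow_succ, smul_mul_smul_comm, mul_comm]

/-- `E_T = ∏_{p ∈ T.toList} E p`. -/
theorem ET_eq_prod_toList (T : Finset ι) : ET T = (T.toList.map E).prod := by
  rw [ET, ← Finset.prod_map_toList]
  have : (((List.map Ec T.toList).prod : Subalgebra.center ℂ (A ι)) : A ι) =
      (Subalgebra.val _) (List.map Ec T.toList).prod := rfl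
  rw [this, map_list_prod, List.map_map]
  rfl

/-- `w_σ̄ ∧ w_σ = (−1)^{n(n−1)/2}·(±1)^n·E_{P₀}`, `n = |P₀|` (T4-A3 Lemma A5.6, the sign). -/
theorem weil_conj_mul_weil (P₀ : Finset ι) (s : Bool) :
    weil P₀ (!s) * weil P₀ s =
      ((-1 : ℂ) ^ (P₀.card.choose 2) * (if s then (1 : ℂ) else -1) ^ P₀.card) • ET P₀ := by
  unfold weil
  rw [mono_map_mul_mono_map]
  simp only [gen_not_mul_gen]
  rw [prod_map_smul, ← ET_eq_prod_toList, smul_smul, Finset.length_toList]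

/-- For four planes the sign is `+1`: `w_σ̄ ∧ w_σ = E_{P₀}` exactly (T4-A3 Lemma A5.6:
six transpositions and four equal signs). -/
theorem weil_conj_mul_weil_four (P₀ : Finset ι) (s : Bool) (h4 : P₀.card = 4) :
    weil P₀ (!s) * weil P₀ s = ET P₀ := by
  have h6 : Nat.choose 4 2 = 6 := by decide
  rw [weil_conj_mul_weil, h4, h6]
  cases s <;> norm_num

/-! ## 3. The detection formula (Lemma A5.6) -/

section Detect

variable [Fintype ι]

/-- `∫_B w_σ̄ ∧ E_{I_σ} ∧ w_σ = vol`, `I_σ := 𝒫 ∖ P₀` (exact; T4-A3 Lemma A5.6). -/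
theorem integral_weil_conj_mul_ET_mul_weil (P₀ : Finset ι) (s : Bool) (h4 : P₀.card = 4) :
    integral (weil P₀ (!s) * ET (Finset.univ \ P₀) * weil P₀ s) = vol ι := by
  rw [mul_assoc, (commute_ET (Finset.univ \ P₀) (weil P₀ (!s))).symm.left_comm,
    weil_conj_mul_weil_four P₀ s h4, ← ET_union Finset.sdiff_disjoint,
    Finset.sdiff_union_of_subset (Finset.subset_univ P₀)]
  rfl

/-- Every generator index is in exactly one of: the planes of `𝒫 ∖ P₀`, `weilList P₀ s`,
`weilList P₀ (!s)`. -/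
theorem mem_planeList_or (P₀ : Finset ι) (s : Bool) (j : Gen ι) :
    j ∈ planeList (Finset.univ \ P₀) ∨ j ∈ weilList P₀ s ∨ j ∈ weilList P₀ (!s) := by
  rw [mem_planeList, mem_weilList, mem_weilList, Finset.mem_sdiff]
  by_cases hp : j.1 ∈ P₀
  · right
    cases hs : j.2 <;> cases s <;> simp_all
  · left
    exact ⟨Finset.mem_univ _, hp⟩

/-- A degree-`|P₀|` monomial `mono l` other than `w_σ̄` pairs to zero with `E_{I_σ} ∧ w_σ`
(T4-A3 Lemma A5.6: the only monomial not killed is `w_σ̄`). -/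
theorem integral_mono_mul_ET_mul_weil_eq_zero (P₀ : Finset ι) (s : Bool) {l : List (Gen ι)}
    (hl : l.Nodup) (hlen : l.length = P₀.card) (hne : l.toFinset ≠ (weilList P₀ (!s)).toFinset) :
    integral (mono l * ET (Finset.univ \ P₀) * weil P₀ s) = 0 := by
  rw [ET_eq_mono, weil_eq_mono, ← mono_append, ← mono_append]
  apply integral_mono_eq_zero
  by_contra hcon
  rw [not_or, not_not] at hcon
  obtain ⟨hnodup, hall⟩ := hcon
  have hall' : ∀ j, j ∈ l ++ planeList (Finset.univ \ P₀) ++ weilList P₀ s :=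
    fun j => not_not.mp fun h => hall ⟨j, h⟩
  apply hne
  -- every generator of `w_σ̄` lies in `l`: it is in the full list but in neither other block
  have hsub : (weilList P₀ (!s)).toFinset ⊆ l.toFinset := by
    intro j hj
    rw [List.mem_toFinset] at hj ⊢
    have hj' := hall' j
    simp only [List.mem_append] at hj'
    rcases hj' with (h | h) | h
    · exact h
    · exact absurd ((mem_planeList.mp h)) (by
        have := (mem_weilList.mp hj).1
        simp [this])
    · have h1 := mem_weilList.mp h
      have h2 := mem_weilList.mp hj
      rw [h1.2] at h2
      cases s <;> simp at h2
  refine (Finset.eq_of_subset_of_card_le hsub ?_).symm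
  rw [List.toFinset_card_of_nodup hl, List.toFinset_card_of_nodup (nodup_weilList P₀ (!s)), hlen,
    length_weilList]

/-- Lemma A5.6 in coordinate form: if `v = λ₀ • w_σ̄ + Σ_{l ∈ S} λ_l • mono l` with every `l ∈ S`
a repetition-free list of length `|P₀|` whose generator set differs from that of `w_σ̄`, then
`∫_B v ∧ E_{I_σ} ∧ w_σ = λ₀·vol`: the pairing with `E_{I_σ} ∧ w_σ` reads off the `w_σ̄`-coordinate. -/
theorem integral_sum_mul_ET_mul_weil (P₀ : Finset ι) (s : Bool) (h4 : P₀.card = 4)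
    (S : Finset (List (Gen ι))) (lam : List (Gen ι) → ℂ) (lam₀ : ℂ)
    (hS : ∀ l ∈ S, l.Nodup ∧ l.length = P₀.card ∧ l.toFinset ≠ (weilList P₀ (!s)).toFinset) :
    integral ((lam₀ • weil P₀ (!s) + ∑ l ∈ S, lam l • mono l) * ET (Finset.univ \ P₀) * weil P₀ s) =
      lam₀ * vol ι := by
  rw [add_mul, add_mul, map_add, smul_mul_assoc, smul_mul_assoc, map_smul,
    integral_weil_conj_mul_ET_mul_weil P₀ s h4, Finset.sum_mul, Finset.sum_mul, map_sum,
    smul_eq_mul]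
  have : ∀ l ∈ S, integral (lam l • mono l * ET (Finset.univ \ P₀) * weil P₀ s) = 0 := by
    intro l hl
    obtain ⟨h1, h2, h3⟩ := hS l hl
    rw [smul_mul_assoc, smul_mul_assoc, map_smul, integral_mono_mul_ET_mul_weil_eq_zero P₀ s h1 h2 h3,
      smul_zero]
  rw [Finset.sum_eq_zero this, add_zero]

/-! ## 4. Lemma (V): the functional `Ψ = ∫_B θ^r ∧ −` on monomials -/

/-- Lemma (V)(i): `∫_B θ^r ∧ mono l = 0` when `l` is HALF in some plane `p` (it contains exactly
one of the two generators of `p`). -/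
theorem integral_theta_pow_mul_mono_eq_zero_of_half (c : ι → ℂ) (r : ℕ) {l : List (Gen ι)}
    {p : ι} {b : Bool} (hin : (p, b) ∈ l) (hout : (p, !b) ∉ l) :
    integral (theta c ^ r * mono l) = 0 := by
  rw [theta_pow, smul_mul_assoc, Finset.sum_mul, map_smul, map_sum]
  simp only [smul_mul_assoc, map_smul, smul_eq_mul]
  refine mul_eq_zero_of_right _ (Finset.sum_eq_zero fun T _ => mul_eq_zero_of_right _ ?_)
  by_cases hp : p ∈ T
  · rw [ET_mul_mono_of_mem hp hin, map_zero]
  · rw [ET_eq_mono, ← mono_append]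
    apply integral_mono_eq_zero
    right
    refine ⟨(p, !b), ?_⟩
    rw [List.mem_append, not_or, mem_planeList]
    exact ⟨hp, hout⟩

/-- Lemma (V)(ii): `∫_B θ^r ∧ E_T = r!·c_{𝒫∖T}·vol` if `T ∪ (𝒫 ∖ T)` has `|𝒫 ∖ T| = r`, i.e.
`|T| = |𝒫| − r`; and `∫_B θ^r ∧ E_T = 0` otherwise. -/
theorem integral_theta_pow_mul_ET (c : ι → ℂ) (r : ℕ) (T : Finset ι) :
    integral (theta c ^ r * ET T) =
      if ((Finset.univ : Finset ι) \ T).card = r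
        then (r.factorial : ℂ) * (∏ p ∈ Finset.univ \ T, c p) * vol ι else 0 := by
  rw [theta_pow, smul_mul_assoc, Finset.sum_mul, map_smul, map_sum]
  simp only [smul_mul_assoc, map_smul, smul_eq_mul]
  -- only `I = 𝒫 ∖ T` can contribute
  have hterm : ∀ I ∈ (Finset.univ : Finset ι).powersetCard r,
      (∏ p ∈ I, c p) * integral (ET I * ET T) =
        if I = Finset.univ \ T then (∏ p ∈ Finset.univ \ T, c p) * vol ι else 0 := by
    intro I hI
    by_cases hdisj : Disjoint I T
    · rw [← ET_union hdisj]
      by_cases hIT : I ∪ T = Finset.univ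
      · have hI' : I = Finset.univ \ T := by
          rw [← hIT, Finset.union_sdiff_right, Finset.sdiff_eq_self_of_disjoint hdisj]
        rw [if_pos hI', hIT, hI']
        rfl
      · rw [if_neg (fun h => hIT (by rw [h, Finset.sdiff_union_of_subset (Finset.subset_univ T)]))]
        rw [ET_eq_mono, integral_mono_eq_zero, mul_zero]
        right
        obtain ⟨j, hj⟩ : ∃ j : Gen ι, j.1 ∉ I ∪ T := by
          by_contra h
          exact hIT (Finset.eq_univ_iff_forall.mpr fun p =>
            not_not.mp fun hp => h ⟨(p, false), hp⟩)
        exact ⟨j, fun h => hj (mem_planeList.mp h)⟩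
    · rw [ET_mul_ET_of_not_disjoint hdisj, map_zero, mul_zero]
      rw [if_neg]
      rintro rfl
      exact hdisj Finset.sdiff_disjoint
  rw [Finset.sum_congr rfl hterm, Finset.sum_ite_eq']
  by_cases hr : ((Finset.univ : Finset ι) \ T).card = r
  · rw [if_pos hr, if_pos (Finset.mem_powersetCard.mpr ⟨Finset.subset_univ _, hr⟩), mul_assoc]
  · rw [if_neg hr, if_neg (fun h => hr (Finset.mem_powersetCard.mp h).2), mul_zero]

end Detect

end Summit.Ventures.HodgeRepro2.WeilDetect
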